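import Mathlib
import HarnessLib
import Summits.Ventures.LatticeQCDFlow.Scoring.SplitChainTourTheorem

/-!
# Tours of the split chain, III: almost surely every tour ends; the segment before the first
# regeneration has mean length `1/ε` and mean square length `(2 − ε)/ε²` from any start

HONEST FRAMING: exact (Metropolis-corrected) sampling algorithms for lattice gauge theory;
figures of merit are autocorrelation/cost numbers at stated couplings and volumes; no
continuum-physics claim.

Venture `LatticeQCDFlow` (cell pub-lqcd), topic `Scoring`; FANOUT row 8 (`s0-cpn-nemc`, GEN-16).
NEW WORK of the cell, not a published result; no definition is introduced.  Notation of
`Scoring/SplitChainTours.lean`: head count `K_t`, tour `i = {t : K_t = i}`, tour functionals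
`S^ψ_i = ∑' u, 1{K_u = i} ψ(x̂_u, x̂_{u+1})`, tour length `N_i = ∑' u, 1{K_u = i}`.  With every tour
start almost surely finite (`Scoring/SplitChainTourTheorem.lean`), the functionals of a tour are
finite sums pathwise (almost surely), `|S^ψ_i| ≤ C N_i` for `|ψ| ≤ C`, and `N_0² = ∑' u, (2u+1) 1{K_u = 0}`;
the tails-run identity `E[1{K_u = 0}] = (1 − ε)^u` (`Scoring/SplitChainGaps.lean`, any initial law)
then gives `E[N_0] = 1/ε` and `E[N_0²] = (2 − ε)/ε²` — the first two moments of a Geometric(`ε`)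
length, as series of integrable functions.  Printed counterpart NAMED ONLY: tour-length moments of
the split chain (Nummelin 1984 §5; Meyn–Tweedie 1993 §17.3; Mykland–Tierney–Yu 1995;
Hobert–Jones–Presnell–Rosenthal 2002) — nothing is cited as a fact.

## Content (`e = ε.toReal`)

* `headCount_pos_of_tourStart`, `tourSum_eq_finsetSum`, `abs_tourSum_le_tourLength`,
  `sq_tourLength_eq_weighted` — pathwise: once tour `i` has ended its functionals are finite sums,
  `|S^ψ_i| ≤ C · N_i` for `|ψ| ≤ C`, and `N_0² = ∑' u, (2u + 1) 1{K_u = 0}`;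
* **`splitChain_ae_tourStart`** — `0 < ε < 1`, any initial law: almost surely, for every `j` there is
  a time `t` with `K_t = j` and `coin_{t+1}` heads (every tour ends);
* **`splitChain_integral_tourLength_zero`** — any initial law: `N_0` is integrable, `E[N_0] = 1/e`;
  **`splitChain_integral_weightedTourLength_zero`**, **`splitChain_integral_sq_tourLength_zero`** —
  `E[∑' u, (2u+1) 1{K_u = 0}] = E[N_0²] = (2 − e)/e²` (both integrable).

NOT CLAIMED: the cycle formula for observables and the estimator (next files); any `ε` of a
concrete sampler.
-/

noncomputable section

namespace Summit.Ventures.LatticeQCDFlow.Scoring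

open MeasureTheory ProbabilityTheory Filter Finset Preorder Literature.Probability.MarkovChains
open scoped ENNReal

/-! ### Pathwise: a tour that has ended is a finite sum -/

section Pathwise

variable {Ω : Type*}

/-- After the start of tour `j + 1` the head count exceeds `j`: if `K_t = j` and `coin_{t+1}` heads
then `K_u ≥ j + 1` for all `u ≥ t + 1`. -/
theorem headCount_pos_of_tourStart (x : ℕ → Ω × Bool) {j t : ℕ}
    (ht : (∑ s ∈ Finset.range t, (if (x (s + 1)).2 then (1 : ℕ) else 0)) = j)
    (hh : (x (t + 1)).2 = true) {u : ℕ} (hu : t + 1 ≤ u) :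
    j + 1 ≤ ∑ s ∈ Finset.range u, (if (x (s + 1)).2 then (1 : ℕ) else 0) := by
  obtain ⟨m, rfl⟩ := Nat.exists_eq_add_of_le hu
  rw [headCount_add, ht, hh]
  simp

/-- **A tour that has ended is a finite sum**: if `K_t = j`, `coin_{t+1}` heads and `i ≤ j`, then
`S^ψ_i(x̂) = Σ_{u < t+1} 1{K_u = i} ψ(x̂_u, x̂_{u+1})`. -/
theorem tourSum_eq_finsetSum (ψ : Ω × Bool → Ω × Bool → ℝ) (x : ℕ → Ω × Bool) {i j t : ℕ}
    (hij : i ≤ j) (ht : (∑ s ∈ Finset.range t, (if (x (s + 1)).2 then (1 : ℕ) else 0)) = j)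
    (hh : (x (t + 1)).2 = true) :
    ∑' u, (if (∑ s ∈ Finset.range u, (if (x (s + 1)).2 then (1 : ℕ) else 0)) = i
        then (1 : ℝ) else 0) * ψ (x u) (x (u + 1))
      = ∑ u ∈ Finset.range (t + 1), (if (∑ s ∈ Finset.range u,
        (if (x (s + 1)).2 then (1 : ℕ) else 0)) = i then (1 : ℝ) else 0) * ψ (x u) (x (u + 1)) := by
  refine tsum_eq_sum fun u hu => ?_
  have hu' : t + 1 ≤ u := by
    by_contra h
    exact hu (Finset.mem_range.2 (by omega))
  have := headCount_pos_of_tourStart x ht hh hu'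
  rw [if_neg (by omega), zero_mul]

/-- **`|S^ψ_i| ≤ C · N_i` once tour `i` has ended**, for `|ψ| ≤ C`. -/
theorem abs_tourSum_le_tourLength {ψ : Ω × Bool → Ω × Bool → ℝ} {C : ℝ} (hC : ∀ p q, |ψ p q| ≤ C)
    (x : ℕ → Ω × Bool) {i j t : ℕ} (hij : i ≤ j)
    (ht : (∑ s ∈ Finset.range t, (if (x (s + 1)).2 then (1 : ℕ) else 0)) = j)
    (hh : (x (t + 1)).2 = true) :
    |∑' u, (if (∑ s ∈ Finset.range u, (if (x (s + 1)).2 then (1 : ℕ) else 0)) = i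
        then (1 : ℝ) else 0) * ψ (x u) (x (u + 1))|
      ≤ C * ∑' u, (if (∑ s ∈ Finset.range u, (if (x (s + 1)).2 then (1 : ℕ) else 0)) = i
        then (1 : ℝ) else 0) := by
  have h1 := tourSum_eq_finsetSum ψ x hij ht hh
  have h2 := tourSum_eq_finsetSum (fun _ _ => (1 : ℝ)) x hij ht hh
  simp only [mul_one] at h2
  rw [h1, h2, Finset.mul_sum]
  refine (Finset.abs_sum_le_sum_abs _ _).trans (Finset.sum_le_sum fun u _ => ?_)
  rw [abs_mul]
  split_ifs
  · rw [abs_one, one_mul, mul_one]; exact hC _ _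
  · simp

/-- **`N_0² = ∑' u, (2u + 1) · 1{K_u = 0}` once tour `0` has ended** (both equal `(t+1)²` when the
first head is at `t + 1`). -/
theorem sq_tourLength_eq_weighted (x : ℕ → Ω × Bool) {t : ℕ}
    (ht : (∑ s ∈ Finset.range t, (if (x (s + 1)).2 then (1 : ℕ) else 0)) = 0)
    (hh : (x (t + 1)).2 = true) :
    (∑' u, (if (∑ s ∈ Finset.range u, (if (x (s + 1)).2 then (1 : ℕ) else 0)) = 0
        then (1 : ℝ) else 0)) ^ 2
      = ∑' u : ℕ, (2 * (u : ℝ) + 1) * (if (∑ s ∈ Finset.range u,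
        (if (x (s + 1)).2 then (1 : ℕ) else 0)) = 0 then (1 : ℝ) else 0) := by
  -- `K_u = 0` iff `u ≤ t`
  have hK : ∀ u, ((∑ s ∈ Finset.range u, (if (x (s + 1)).2 then (1 : ℕ) else 0)) = 0) ↔ u ≤ t := by
    intro u
    constructor
    · intro hu
      by_contra h
      have := headCount_pos_of_tourStart x ht hh (show t + 1 ≤ u by omega)
      omega
    · intro hu
      have := headCount_mono x hu
      omega
  have hz1 : ∀ u ∉ Finset.range (t + 1), (if (∑ s ∈ Finset.range u,
      (if (x (s + 1)).2 then (1 : ℕ) else 0)) = 0 then (1 : ℝ) else 0) = 0 := fun u hu => by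
    rw [if_neg ((hK u).not.2 (by have := Finset.mem_range.not.1 hu; omega))]
  have hz2 : ∀ u ∉ Finset.range (t + 1), (2 * (u : ℝ) + 1) * (if (∑ s ∈ Finset.range u,
      (if (x (s + 1)).2 then (1 : ℕ) else 0)) = 0 then (1 : ℝ) else 0) = 0 := fun u hu => by
    rw [hz1 u hu, mul_zero]
  have h1 : ∑' u, (if (∑ s ∈ Finset.range u, (if (x (s + 1)).2 then (1 : ℕ) else 0)) = 0
      then (1 : ℝ) else 0) = ∑ u ∈ Finset.range (t + 1), (1 : ℝ) := by
    rw [tsum_eq_sum hz1]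
    exact Finset.sum_congr rfl fun u hu => by
      rw [if_pos ((hK u).2 (by have := Finset.mem_range.1 hu; omega))]
  have h2 : ∑' u : ℕ, (2 * (u : ℝ) + 1) * (if (∑ s ∈ Finset.range u,
      (if (x (s + 1)).2 then (1 : ℕ) else 0)) = 0 then (1 : ℝ) else 0)
      = ∑ u ∈ Finset.range (t + 1), (2 * (u : ℝ) + 1) := by
    rw [tsum_eq_sum hz2]
    exact Finset.sum_congr rfl fun u hu => by
      rw [if_pos ((hK u).2 (by have := Finset.mem_range.1 hu; omega)), mul_one]
  rw [h1, h2, Finset.sum_const, Finset.card_range, nsmul_eq_mul, mul_one]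
  have key : ∀ n : ℕ, ∑ u ∈ Finset.range n, (2 * (u : ℝ) + 1) = (n : ℝ) ^ 2 := by
    intro n
    induction n with
    | zero => simp
    | succ n ih => rw [Finset.sum_range_succ, ih]; push_cast; ring
  rw [key]

end Pathwise

/-! ### Almost surely every tour ends -/

section AlmostSure

variable {Ω : Type*} [MeasurableSpace Ω]
  {κ : Kernel Ω Ω} [IsMarkovKernel κ] {ν : Measure Ω} [IsProbabilityMeasure ν] {ε : ℝ≥0∞}
  {hmin : ∀ x {B : Set Ω}, MeasurableSet B → ε * ν B ≤ κ x B}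
  (κs : Kernel (Ω × Bool) (Ω × Bool)) [IsMarkovKernel κs]
  (μs : Measure (Ω × Bool)) [IsProbabilityMeasure μs]

/-- **ALMOST SURELY EVERY TOUR ENDS** (`0 < ε < 1`, any initial law): for almost every path, for
every `j` there is a time `t` with `K_t = j` and `coin_{t+1}` heads. -/
theorem splitChain_ae_tourStart (hε0 : 0 < ε) (hε : ε < 1)
    (hκs : ∀ p, κs p = (ε • ν).map (fun y : Ω => (y, true))
      + ((1 - ε) • Doeblin.residualKernel κ ν ε hmin p.1).map (fun y : Ω => (y, false))) :
    ∀ᵐ x ∂(Kernel.trajMeasure (X := fun _ : ℕ => Ω × Bool) μs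
        (fun n : ℕ => κs.comap (fun h : (i : ↥(Finset.Iic n)) → Ω × Bool =>
          h ⟨n, Finset.mem_Iic.2 le_rfl⟩) (measurable_pi_apply _))),
      ∀ j : ℕ, ∃ t : ℕ, (∑ s ∈ Finset.range t, (if (x (s + 1)).2 then (1 : ℕ) else 0)) = j
        ∧ (x (t + 1)).2 = true := by
  set P := Kernel.trajMeasure (X := fun _ : ℕ => Ω × Bool) μs
      (fun n : ℕ => κs.comap (fun h : (i : ↥(Finset.Iic n)) → Ω × Bool =>
        h ⟨n, Finset.mem_Iic.2 le_rfl⟩) (measurable_pi_apply _)) with hP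
  rw [ae_all_iff]
  intro j
  -- the tour-start series `S_j ∈ [0, 1]` has integral `1`, hence equals `1` a.e.
  have hSm : Measurable fun x : ℕ → Ω × Bool => ∑' t, (if (∑ s ∈ Finset.range t,
      (if (x (s + 1)).2 then (1 : ℕ) else 0)) = j then (1 : ℝ) else 0)
      * (if (x (t + 1)).2 then (1 : ℝ) else 0) :=
    Measurable.tsum fun t => (measurable_headCountIndicator t j).mul (measurable_coinHeads (t + 1))
  have hSi : Integrable (fun x : ℕ → Ω × Bool => 1 - ∑' t, (if (∑ s ∈ Finset.range t,
      (if (x (s + 1)).2 then (1 : ℕ) else 0)) = j then (1 : ℝ) else 0)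
      * (if (x (t + 1)).2 then (1 : ℝ) else 0)) P :=
    integrable_of_bounded P (measurable_const.sub hSm) (C := 1) fun x => by
      rw [abs_of_nonneg (sub_nonneg.2 (tourStart_tsum_mem x j).2)]
      linarith [(tourStart_tsum_mem x j).1]
  have h0 : ∫ x, (1 - ∑' t, (if (∑ s ∈ Finset.range t,
      (if (x (s + 1)).2 then (1 : ℕ) else 0)) = j then (1 : ℝ) else 0)
      * (if (x (t + 1)).2 then (1 : ℝ) else 0)) ∂P = 0 := by
    rw [integral_sub (integrable_const _) (integrable_of_bounded P hSm (C := 1) fun x => by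
      rw [abs_of_nonneg (tourStart_tsum_mem x j).1]; exact (tourStart_tsum_mem x j).2),
      integral_const, probReal_univ, one_smul, hP,
      splitChain_tourStart_finite κs μs (κ := κ) (ν := ν) (hmin := hmin) hε0 hε hκs j, sub_self]
  have hae := (integral_eq_zero_iff_of_nonneg_ae (ae_of_all _ fun x =>
    sub_nonneg.2 (tourStart_tsum_mem x j).2) hSi).1 h0
  filter_upwards [hae] with x hx
  have hx1 : ∑' t, (if (∑ s ∈ Finset.range t, (if (x (s + 1)).2 then (1 : ℕ) else 0)) = j
      then (1 : ℝ) else 0) * (if (x (t + 1)).2 then (1 : ℝ) else 0) = 1 := by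
    have : (1 : ℝ) - _ = 0 := hx
    linarith
  by_contra hne
  push Not at hne
  have hzero : ∀ t, (if (∑ s ∈ Finset.range t, (if (x (s + 1)).2 then (1 : ℕ) else 0)) = j
      then (1 : ℝ) else 0) * (if (x (t + 1)).2 then (1 : ℝ) else 0) = 0 := fun t => by
    by_cases h1 : (∑ s ∈ Finset.range t, (if (x (s + 1)).2 then (1 : ℕ) else 0)) = j
    · rw [if_neg (hne t h1), mul_zero]
    · rw [if_neg h1, zero_mul]
  rw [tsum_congr hzero, tsum_zero] at hx1
  exact zero_ne_one hx1

end AlmostSure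

/-! ### Moments of the first tour -/

section Moments

variable {Ω : Type*} [MeasurableSpace Ω]
  {κ : Kernel Ω Ω} [IsMarkovKernel κ] {ν : Measure Ω} [IsProbabilityMeasure ν] {ε : ℝ≥0∞}
  {hmin : ∀ x {B : Set Ω}, MeasurableSet B → ε * ν B ≤ κ x B}
  (κs : Kernel (Ω × Bool) (Ω × Bool)) [IsMarkovKernel κs]
  (μs : Measure (Ω × Bool)) [IsProbabilityMeasure μs]

/-- **`E[N_0] = 1/ε` from any start**: the number of states before the first regeneration,
`N_0 = ∑' u, 1{K_u = 0}`, is integrable with mean `1/e`. -/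
theorem splitChain_integral_tourLength_zero (hε0 : 0 < ε) (hε : ε < 1)
    (hκs : ∀ p, κs p = (ε • ν).map (fun y : Ω => (y, true))
      + ((1 - ε) • Doeblin.residualKernel κ ν ε hmin p.1).map (fun y : Ω => (y, false))) :
    Integrable (fun x : ℕ → Ω × Bool => ∑' u, (if (∑ s ∈ Finset.range u,
        (if (x (s + 1)).2 then (1 : ℕ) else 0)) = 0 then (1 : ℝ) else 0))
      (Kernel.trajMeasure (X := fun _ : ℕ => Ω × Bool) μs
        (fun n : ℕ => κs.comap (fun h : (i : ↥(Finset.Iic n)) → Ω × Bool =>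
          h ⟨n, Finset.mem_Iic.2 le_rfl⟩) (measurable_pi_apply _)))
    ∧ ∫ x, ∑' u, (if (∑ s ∈ Finset.range u, (if (x (s + 1)).2 then (1 : ℕ) else 0)) = 0
        then (1 : ℝ) else 0)
        ∂(Kernel.trajMeasure (X := fun _ : ℕ => Ω × Bool) μs
          (fun n : ℕ => κs.comap (fun h : (i : ↥(Finset.Iic n)) → Ω × Bool =>
            h ⟨n, Finset.mem_Iic.2 le_rfl⟩) (measurable_pi_apply _))) = 1 / ε.toReal := by
  set P := Kernel.trajMeasure (X := fun _ : ℕ => Ω × Bool) μs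
      (fun n : ℕ => κs.comap (fun h : (i : ↥(Finset.Iic n)) → Ω × Bool =>
        h ⟨n, Finset.mem_Iic.2 le_rfl⟩) (measurable_pi_apply _)) with hP
  have he0 : 0 < ε.toReal := ENNReal.toReal_pos hε0.ne' (ne_top_of_lt hε)
  have he1 : ε.toReal ≤ 1 := by
    have := (ENNReal.toReal_lt_toReal (ne_top_of_lt hε) ENNReal.one_ne_top).2 hε
    rw [ENNReal.toReal_one] at this
    exact this.le
  -- each term `1{K_u = 0} = T_{0,u}` has integral `(1 - e)^u`
  have hterm : ∀ u, ∫ x, (if (∑ s ∈ Finset.range u, (if (x (s + 1)).2 then (1 : ℕ) else 0)) = 0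
      then (1 : ℝ) else 0) ∂P = (1 - ε.toReal) ^ u := by
    intro u
    simp_rw [headCount_eq_zero_indicator]
    have h := splitChain_tailsRun κs μs (κ := κ) (ν := ν) (hmin := hmin) hε hκs 0
      (G := fun _ => (1 : ℝ)) measurable_const (fun _ _ _ => rfl) (CG := 1) (fun _ => by simp) u
    simp only [one_mul, Nat.zero_add, integral_const, probReal_univ, one_smul, mul_one] at h
    rw [hP]
    exact h
  have hint : ∀ u, Integrable (fun x : ℕ → Ω × Bool => (if (∑ s ∈ Finset.range u,
      (if (x (s + 1)).2 then (1 : ℕ) else 0)) = 0 then (1 : ℝ) else 0)) P := fun u =>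
    integrable_of_bounded P (measurable_headCountIndicator u 0) (C := 1) fun x => by
      split_ifs <;> simp
  have hnorm : ∀ u, ∫ x, ‖(if (∑ s ∈ Finset.range u, (if (x (s + 1)).2 then (1 : ℕ) else 0)) = 0
      then (1 : ℝ) else 0)‖ ∂P = (1 - ε.toReal) ^ u := fun u => by
    rw [← hterm u]
    exact integral_congr_ae (ae_of_all _ fun x => by
      beta_reduce; rw [Real.norm_eq_abs, abs_of_nonneg (by split_ifs <;> norm_num)])
  have hgeom : HasSum (fun u : ℕ => (1 - ε.toReal) ^ u) (1 / ε.toReal) := by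
    have h := hasSum_geometric_of_lt_one (by linarith) (by linarith : 1 - ε.toReal < 1)
    rwa [sub_sub_cancel, ← one_div] at h
  have hsum : Summable fun u => ∫ x, ‖(if (∑ s ∈ Finset.range u,
      (if (x (s + 1)).2 then (1 : ℕ) else 0)) = 0 then (1 : ℝ) else 0)‖ ∂P := by
    simp_rw [hnorm]; exact hgeom.summable
  refine ⟨integrable_tsum_of_summable_integral_norm P hint hsum, ?_⟩
  rw [← integral_tsum_of_summable_integral_norm hint hsum]
  simp_rw [hterm]
  exact hgeom.tsum_eq

/-- **`E[∑' u, (2u + 1) 1{K_u = 0}] = (2 − ε)/ε²` from any start** (integrable). -/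
theorem splitChain_integral_weightedTourLength_zero (hε0 : 0 < ε) (hε : ε < 1)
    (hκs : ∀ p, κs p = (ε • ν).map (fun y : Ω => (y, true))
      + ((1 - ε) • Doeblin.residualKernel κ ν ε hmin p.1).map (fun y : Ω => (y, false))) :
    Integrable (fun x : ℕ → Ω × Bool => ∑' u : ℕ, (2 * (u : ℝ) + 1) * (if (∑ s ∈ Finset.range u,
        (if (x (s + 1)).2 then (1 : ℕ) else 0)) = 0 then (1 : ℝ) else 0))
      (Kernel.trajMeasure (X := fun _ : ℕ => Ω × Bool) μs
        (fun n : ℕ => κs.comap (fun h : (i : ↥(Finset.Iic n)) → Ω × Bool =>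
          h ⟨n, Finset.mem_Iic.2 le_rfl⟩) (measurable_pi_apply _)))
    ∧ ∫ x, ∑' u : ℕ, (2 * (u : ℝ) + 1) * (if (∑ s ∈ Finset.range u,
        (if (x (s + 1)).2 then (1 : ℕ) else 0)) = 0 then (1 : ℝ) else 0)
        ∂(Kernel.trajMeasure (X := fun _ : ℕ => Ω × Bool) μs
          (fun n : ℕ => κs.comap (fun h : (i : ↥(Finset.Iic n)) → Ω × Bool =>
            h ⟨n, Finset.mem_Iic.2 le_rfl⟩) (measurable_pi_apply _)))
      = (2 - ε.toReal) / ε.toReal ^ 2 := by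
  set P := Kernel.trajMeasure (X := fun _ : ℕ => Ω × Bool) μs
      (fun n : ℕ => κs.comap (fun h : (i : ↥(Finset.Iic n)) → Ω × Bool =>
        h ⟨n, Finset.mem_Iic.2 le_rfl⟩) (measurable_pi_apply _)) with hP
  have he0 : 0 < ε.toReal := ENNReal.toReal_pos hε0.ne' (ne_top_of_lt hε)
  have he1 : ε.toReal ≤ 1 := by
    have := (ENNReal.toReal_lt_toReal (ne_top_of_lt hε) ENNReal.one_ne_top).2 hε
    rw [ENNReal.toReal_one] at this
    exact this.le
  have hterm : ∀ u : ℕ, ∫ x, (2 * (u : ℝ) + 1) * (if (∑ s ∈ Finset.range u,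
      (if (x (s + 1)).2 then (1 : ℕ) else 0)) = 0 then (1 : ℝ) else 0) ∂P
      = (2 * (u : ℝ) + 1) * (1 - ε.toReal) ^ u := by
    intro u
    rw [integral_const_mul]
    congr 1
    simp_rw [headCount_eq_zero_indicator]
    have h := splitChain_tailsRun κs μs (κ := κ) (ν := ν) (hmin := hmin) hε hκs 0
      (G := fun _ => (1 : ℝ)) measurable_const (fun _ _ _ => rfl) (CG := 1) (fun _ => by simp) u
    simp only [one_mul, Nat.zero_add, integral_const, probReal_univ, one_smul, mul_one] at h
    rw [hP]
    exact h
  have hu0 : ∀ u : ℕ, 0 ≤ 2 * (u : ℝ) + 1 := fun u => by positivity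
  have hint : ∀ u : ℕ, Integrable (fun x : ℕ → Ω × Bool => (2 * (u : ℝ) + 1) * (if (∑ s ∈ Finset.range u,
      (if (x (s + 1)).2 then (1 : ℕ) else 0)) = 0 then (1 : ℝ) else 0)) P := fun u =>
    integrable_of_bounded P (measurable_const.mul (measurable_headCountIndicator u 0))
      (C := (2 * (u : ℝ) + 1) * 1) fun x => by
      rw [abs_mul, abs_of_nonneg (hu0 u)]
      refine mul_le_mul_of_nonneg_left ?_ (hu0 u)
      split_ifs <;> simp
  have hnorm : ∀ u : ℕ, ∫ x, ‖(2 * (u : ℝ) + 1) * (if (∑ s ∈ Finset.range u,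
      (if (x (s + 1)).2 then (1 : ℕ) else 0)) = 0 then (1 : ℝ) else 0)‖ ∂P
      = (2 * (u : ℝ) + 1) * (1 - ε.toReal) ^ u := fun u => by
    rw [← hterm u]
    exact integral_congr_ae (ae_of_all _ fun x => by
      beta_reduce
      rw [Real.norm_eq_abs, abs_of_nonneg (mul_nonneg (hu0 u) (by split_ifs <;> norm_num))])
  -- `∑ (2u+1) r^u = 2 r/(1-r)² + 1/(1-r)` with `r = 1 - e`
  have hr : ‖(1 - ε.toReal)‖ < 1 := by rw [Real.norm_eq_abs, abs_of_nonneg (by linarith)]; linarith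
  have hS1 : HasSum (fun u : ℕ => (u : ℝ) * (1 - ε.toReal) ^ u)
      ((1 - ε.toReal) / (1 - (1 - ε.toReal)) ^ 2) := hasSum_coe_mul_geometric_of_norm_lt_one hr
  have hS2 : HasSum (fun u : ℕ => (1 - ε.toReal) ^ u) (1 - (1 - ε.toReal))⁻¹ :=
    hasSum_geometric_of_lt_one (by linarith) (by linarith)
  have hS : HasSum (fun u : ℕ => (2 * (u : ℝ) + 1) * (1 - ε.toReal) ^ u)
      ((2 - ε.toReal) / ε.toReal ^ 2) := by
    have h := (hS1.mul_left 2).add hS2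
    rw [sub_sub_cancel] at h
    have hfun : (fun u : ℕ => (2 * (u : ℝ) + 1) * (1 - ε.toReal) ^ u)
        = fun b : ℕ => 2 * ((b : ℝ) * (1 - ε.toReal) ^ b) + (1 - ε.toReal) ^ b :=
      funext fun u => by ring
    have hval : (2 - ε.toReal) / ε.toReal ^ 2
        = 2 * ((1 - ε.toReal) / ε.toReal ^ 2) + (ε.toReal)⁻¹ := by
      field_simp
      ring
    rw [hfun, hval]
    exact h
  have hsum : Summable fun u : ℕ => ∫ x, ‖(2 * (u : ℝ) + 1) * (if (∑ s ∈ Finset.range u,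
      (if (x (s + 1)).2 then (1 : ℕ) else 0)) = 0 then (1 : ℝ) else 0)‖ ∂P := by
    simp_rw [hnorm]; exact hS.summable
  refine ⟨integrable_tsum_of_summable_integral_norm P hint hsum, ?_⟩
  rw [← integral_tsum_of_summable_integral_norm hint hsum]
  simp_rw [hterm]
  exact hS.tsum_eq

/-- **`E[N_0²] = (2 − ε)/ε²` from any start** (`0 < ε < 1`; `N_0²` integrable). -/
theorem splitChain_integral_sq_tourLength_zero (hε0 : 0 < ε) (hε : ε < 1)
    (hκs : ∀ p, κs p = (ε • ν).map (fun y : Ω => (y, true))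
      + ((1 - ε) • Doeblin.residualKernel κ ν ε hmin p.1).map (fun y : Ω => (y, false))) :
    Integrable (fun x : ℕ → Ω × Bool => (∑' u, (if (∑ s ∈ Finset.range u,
        (if (x (s + 1)).2 then (1 : ℕ) else 0)) = 0 then (1 : ℝ) else 0)) ^ 2)
      (Kernel.trajMeasure (X := fun _ : ℕ => Ω × Bool) μs
        (fun n : ℕ => κs.comap (fun h : (i : ↥(Finset.Iic n)) → Ω × Bool =>
          h ⟨n, Finset.mem_Iic.2 le_rfl⟩) (measurable_pi_apply _)))
    ∧ ∫ x, (∑' u, (if (∑ s ∈ Finset.range u, (if (x (s + 1)).2 then (1 : ℕ) else 0)) = 0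
        then (1 : ℝ) else 0)) ^ 2
        ∂(Kernel.trajMeasure (X := fun _ : ℕ => Ω × Bool) μs
          (fun n : ℕ => κs.comap (fun h : (i : ↥(Finset.Iic n)) → Ω × Bool =>
            h ⟨n, Finset.mem_Iic.2 le_rfl⟩) (measurable_pi_apply _)))
      = (2 - ε.toReal) / ε.toReal ^ 2 := by
  obtain ⟨hI, hE⟩ := splitChain_integral_weightedTourLength_zero κs μs (κ := κ) (ν := ν)
    (hmin := hmin) hε0 hε hκs
  have hae : ∀ᵐ x ∂(Kernel.trajMeasure (X := fun _ : ℕ => Ω × Bool) μs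
      (fun n : ℕ => κs.comap (fun h : (i : ↥(Finset.Iic n)) → Ω × Bool =>
        h ⟨n, Finset.mem_Iic.2 le_rfl⟩) (measurable_pi_apply _))),
      (∑' u, (if (∑ s ∈ Finset.range u, (if (x (s + 1)).2 then (1 : ℕ) else 0)) = 0
        then (1 : ℝ) else 0)) ^ 2
      = ∑' u : ℕ, (2 * (u : ℝ) + 1) * (if (∑ s ∈ Finset.range u,
        (if (x (s + 1)).2 then (1 : ℕ) else 0)) = 0 then (1 : ℝ) else 0) := by
    filter_upwards [splitChain_ae_tourStart κs μs (κ := κ) (ν := ν) (hmin := hmin) hε0 hε hκs]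
      with x hx
    obtain ⟨t, ht, hh⟩ := hx 0
    exact sq_tourLength_eq_weighted x ht hh
  exact ⟨hI.congr (Filter.EventuallyEq.symm hae), (integral_congr_ae hae).trans hE⟩


end Moments

end Summit.Ventures.LatticeQCDFlow.Scoring

end
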